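import Mathlib
import HarnessLib
import Summits.Ventures.LatticeQCDFlow.Exactness.FibreLift
import Summits.Ventures.LatticeQCDFlow.Exactness.Overrelaxation

/-!
# Weight-conserving involutions on one coordinate with the rest frozen: local over-relaxation is exact for the full measure

HONEST FRAMING: exact (Metropolis-corrected) sampling algorithms for lattice gauge theory;
figures of merit are autocorrelation/cost numbers at stated couplings and volumes; no
continuum-physics claim.

Venture `LatticeQCDFlow` (cell pub-lqcd), topic `Exactness`, FANOUT row 9 (eng-latcore, the
engine `latflow.core`).  NEW WORK of the cell over Mathlib; nothing here is cited as a fact.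

Glue between `Overrelaxation.lean` (a measure-preserving involution that conserves the weight
is exact, acceptance one; `reflectThrough s : g ↦ s g⁻¹ s`) and `FibreLift.lean`
(`freezeSnd_isReversible`).  The engine's over-relaxation (`updates.sweep(f, β, mode = 'or')`,
the `nOR` part of `composite_sweep`) reflects ONE link through the normalised staple `ŝ(y)`,
which depends on the frozen neighbours `y`; this file carries that `y`-dependence.

## Content (general `ℝ≥0∞` density `p` instead of `e^{−H}`, so it composes with `FibreLift`)

* `measurePreserving_withDensity_of_invariant` — `Φ` preserves `μ` and `p ∘ Φ = p` ⇒ `Φ`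
  preserves `p · μ`; `involution_isReversible` — if moreover `Φ` is an involution, the
  deterministic kernel of `Φ` is reversible for `p · μ`.
* `fibre_deterministic` — the fibre at `y` of the deterministic `X`-update `(x, y) ↦ Φ y x` is the
  deterministic kernel of `Φ y`; **`localInvolution_isReversible`** — if every `Φ y` is a
  `μ`-preserving involution with `p (Φ y x, y) = p (x, y)`, the lifted update is reversible for
  `p · (μ ⊗ ν)`.
* **`localOverrelaxation_isReversible`** — the instance: `X = G` a measurable group with a left-,
  right- and inversion-invariant `μ` (Haar of a compact group), `Φ y = reflectThrough (s y)` for a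
  measurable staple map `s : Y → G`, any measurable joint weight with `p (s(y) U⁻¹ s(y), y) =
  p (U, y)`: over-relaxation of one link with the lattice frozen is reversible for `p · (μ ⊗ ν)`.

Not here: that the Wilson weight satisfies the invariance for `s(y)` = the normalised staple
(the SU(2) trace identity, stated in `Overrelaxation.lean`'s header; checked numerically by
acceptance test A5), sweeps, ergodicity.
-/

namespace Summit.Ventures.LatticeQCDFlow.Exactness

open MeasureTheory ProbabilityTheory
open scoped ENNReal

variable {X Y : Type*} [MeasurableSpace X] [MeasurableSpace Y]

/-! ## §1 One coordinate: weight-conserving measure-preserving involutions -/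

/-- A `μ`-preserving map that conserves the density `p` preserves `p · μ`. -/
theorem measurePreserving_withDensity_of_invariant {μ : Measure X} {Φ : X → X} {p : X → ℝ≥0∞}
    (hΦ : MeasurePreserving Φ μ μ) (hp : Measurable p) (hinv : ∀ x, p (Φ x) = p x) :
    MeasurePreserving Φ (μ.withDensity p) (μ.withDensity p) := by
  refine ⟨hΦ.measurable, Measure.ext fun s hs => ?_⟩
  rw [Measure.map_apply hΦ.measurable hs, withDensity_apply _ hs,
    withDensity_apply _ (hΦ.measurable hs)]
  calc ∫⁻ x in Φ ⁻¹' s, p x ∂μ = ∫⁻ x in Φ ⁻¹' s, p (Φ x) ∂μ := by simp_rw [hinv]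
    _ = ∫⁻ y in s, p y ∂(μ.map Φ) := (setLIntegral_map hs hp hΦ.measurable).symm
    _ = ∫⁻ y in s, p y ∂μ := by rw [hΦ.map_eq]

/-- The mass flow of a deterministic kernel: `∫_A δ_{Φ x}(B) dπ = π (Φ⁻¹ B ∩ A)`. -/
theorem setLIntegral_deterministic {π : Measure X} {Φ : X → X} (hΦ : Measurable Φ) {A B : Set X}
    (hB : MeasurableSet B) :
    ∫⁻ x in A, Kernel.deterministic Φ hΦ x B ∂π = π (Φ ⁻¹' B ∩ A) := by
  have h : ∀ x, Kernel.deterministic Φ hΦ x B = (Φ ⁻¹' B).indicator 1 x := fun x => by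
    rw [Kernel.deterministic_apply, Measure.dirac_apply' _ hB]; rfl
  simp_rw [h]
  rw [lintegral_indicator_one (hΦ hB), Measure.restrict_apply (hΦ hB)]

/-- **A measure-preserving involution that conserves the weight is exact** (acceptance one): the
deterministic kernel of `Φ` is reversible for `p · μ`. -/
theorem involution_isReversible {μ : Measure X} {Φ : X → X} {p : X → ℝ≥0∞}
    (hΦ : MeasurePreserving Φ μ μ) (hinvol : Function.Involutive Φ) (hp : Measurable p)
    (hinv : ∀ x, p (Φ x) = p x) :
    Kernel.IsReversible (Kernel.deterministic Φ hΦ.measurable) (μ.withDensity p) := by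
  intro A B hA hB
  have hπ := measurePreserving_withDensity_of_invariant hΦ hp hinv
  rw [setLIntegral_deterministic hΦ.measurable hB, setLIntegral_deterministic hΦ.measurable hA,
    ← hπ.measure_preimage ((hΦ.measurable hA).inter hB).nullMeasurableSet, Set.preimage_inter,
    ← Set.preimage_comp, hinvol.comp_self, Set.preimage_id, Set.inter_comm]

/-! ## §2 With the rest frozen -/

/-- The fibre at `y` of the deterministic `X`-update `(x, y) ↦ Φ y x` is the deterministic kernel
of `Φ y`. -/
theorem fibre_deterministic {Φ : Y → X → X} (hΦm : Measurable fun z : X × Y => Φ z.2 z.1) (y : Y)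
    (hy : Measurable (Φ y)) :
    fibre (Kernel.deterministic (fun z : X × Y => Φ z.2 z.1) hΦm) y = Kernel.deterministic (Φ y) hy := by
  ext x s hs
  rw [fibre_apply, Kernel.deterministic_apply, Kernel.deterministic_apply]

/-- **Local involutions are exact for the joint weight.**  If for every frozen `y` the map `Φ y`
is a `μ`-preserving involution conserving `p(·, y)`, the lifted deterministic update
`(x, y) ↦ (Φ y x, y)` is reversible for `p · (μ ⊗ ν)`. -/
theorem localInvolution_isReversible {μ : Measure X} {ν : Measure Y} [SFinite μ] [SFinite ν]
    {Φ : Y → X → X} {p : X × Y → ℝ≥0∞} (hΦm : Measurable fun z : X × Y => Φ z.2 z.1)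
    (hvol : ∀ y, MeasurePreserving (Φ y) μ μ) (hinvol : ∀ y, Function.Involutive (Φ y))
    (hp : Measurable p) (hinv : ∀ y x, p (Φ y x, y) = p (x, y)) :
    Kernel.IsReversible (freezeSnd (Kernel.deterministic (fun z : X × Y => Φ z.2 z.1) hΦm))
      ((μ.prod ν).withDensity p) := by
  refine freezeSnd_isReversible _ hp (fun y => ?_)
  rw [fibre_deterministic hΦm y (hvol y).measurable]
  exact involution_isReversible (hvol y) (hinvol y) (hp.comp measurable_prodMk_right) (hinv y)

/-- **Local over-relaxation is exact.**  Links in a measurable group `G` with a left-, right- and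
inversion-invariant `μ` (Haar of a compact group); a measurable "staple" map `s : Y → G` of the
frozen rest; any measurable joint weight `p` with `p (s(y) U⁻¹ s(y), y) = p (U, y)`: reflecting
one link through `s(y)` with the lattice frozen is reversible for `p · (μ ⊗ ν)`. -/
theorem localOverrelaxation_isReversible {G : Type*} [Group G] [MeasurableSpace G]
    [MeasurableMul₂ G] [MeasurableInv G] {μ : Measure G} [SFinite μ] [μ.IsMulLeftInvariant]
    [μ.IsMulRightInvariant] [μ.IsInvInvariant] {ν : Measure Y} [SFinite ν] {s : Y → G}
    (hs : Measurable s) {p : G × Y → ℝ≥0∞} (hp : Measurable p)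
    (hinv : ∀ y U, p (s y * U⁻¹ * s y, y) = p (U, y)) :
    Kernel.IsReversible
      (freezeSnd (Kernel.deterministic (fun z : G × Y => reflectThrough (s z.2) z.1)
        (((hs.comp measurable_snd).mul measurable_fst.inv).mul (hs.comp measurable_snd))))
      ((μ.prod ν).withDensity p) :=
  localInvolution_isReversible (Φ := fun y U => reflectThrough (s y) U) _
    (fun y => measurePreserving_reflectThrough μ (s y)) (fun y => reflectThrough_involutive (s y)) hp
    (fun y U => hinv y U)

end Summit.Ventures.LatticeQCDFlow.Exactness
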